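import Mathlib.NumberTheory.EulerProduct.Basic
import Mathlib.NumberTheory.SmoothNumbers
import Literature.NumberTheory.Sieve.AsymptoticSieveForPrimesLogSums
import Literature.NumberTheory.LFunctions.MertensElementary
import HarnessLib

/-!
# The Möbius harmonic sum over rough numbers: `F(w, z) = ∑_{n ≤ w, (n, P(z)) = 1} μ(n)/n`

Topic `Literature/NumberTheory/Sieve` (trunk T-SIEVE), an input to the proof of Friedlander–Iwaniec's
Möbius–density cancellation (2.4) (`Literature.NumberTheory.Sieve.fi_moebius_density_cancellation`,
`AsymptoticSieveForPrimesInputs.lean`). Everything in this file is PROVED (no named facts).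

In the proof of (2.4) (FI pp. 1048–1049) the comparison function is `f(n) = 1/n` and one needs
"`F(w, z) = ∑_{n ≤ w, (n, P(z)) = 1} μ(n) f(n) ≪ z^{-c} + exp(-log w/log z)(log z)⁶`, which can be
proven by a standard contour integration". We prove a bound of the same shape by an elementary
route from the tree's PROVED estimate `m(x) = ∑_{k ≤ x} μ(k)/k ≪ exp(-c√log x)`
(`Literature.NumberTheory.LFunctions.abs_sum_moebius_div_le_exp_neg_sqrt_log`, `MoebiusHarmonicSumBound.lean`, itself from the
classical zero-free region), taken here as a hypothesis `hm` so that this file does not depend on it: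

* `ite_coprime_moebius_eq_sum_divisors` — the Legendre-type identity
  `μ(n)[(n, P) = 1] = ∑_{b ∣ n, b smooth} μ(n/b)` (`P = ∏_{q < N} q`), i.e.
  `∏_{p ≥ N} (1 - p^{-s}) = ∏_{p < N} (1 - p^{-s})⁻¹ ∏_p (1 - p^{-s})`, proved by comparing the
  multiplicative functions `(μ·1_{rough}) * ζ` and `1_{smooth}` on prime powers;
* `sum_coprime_moebius_div_eq` — hence `F = ∑_{b ≤ w, b smooth} b⁻¹ m(w/b)`;
* `sum_rpow_neg_le_prod_of_smooth` — `∑_{b smooth} b^{-t} ≤ ∏_{p < N} (1 - p^{-t})⁻¹` (`t > 0`;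
  Mathlib's Euler product over smooth numbers), with the two products bounded by
  `e⁵ log N` (`t = 1`, the tree's elementary Mertens bound) and `(e⁵ log N)^{12}`
  (`t = 1 - 1/log N`, Rankin's trick: `rankin_factor_le`, `rankin_prod_le`);
* `abs_sum_coprime_moebius_div_le` — **the bound**: for `w ≥ 2`, `N ≥ 8`,
  `|F| ≤ (C+1) e^{c+5} log N · e^{-(c/2)√log w} + (C+1)(e⁵ log N)^{12} e^{-log w/(2 log N)}`
  (split at `b = √w`: `|m(w/b)| ≤ C e^{-c√(log w/2)}` for `b ≤ √w`, `|m| ≤ C + 1` and Rankin for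
  `b > √w`).

## References

* J. Friedlander, H. Iwaniec, *Asymptotic sieve for primes*, Ann. of Math. 148 (1998),
  1041–1065, §2, p. 1049. [FriedlanderIwaniecASP1998]
* H. L. Montgomery, R. C. Vaughan, *Multiplicative Number Theory I*, CUP 2007, §7.1 (smooth
  numbers, Rankin's method). [MontgomeryVaughan2007]

## Mathlib / tree

Mathlib: `EulerProduct.summable_and_hasSum_smoothNumbers_prod_primesBelow_geometric`,
`Nat.smoothNumbers`, `ArithmeticFunction.IsMultiplicative.eq_iff_eq_on_prime_powers`,
`ArithmeticFunction.coe_zeta_mul_coe_moebius`, `Nat.floor_div_natCast`. The tree: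
`Literature.NumberTheory.Sieve.filter_dvd_Icc_eq_image` (`AsymptoticSieveForPrimesLogSums`),
`Literature.NumberTheory.LFunctions.MertensBound.exp_neg_div_log_le_prod_one_sub_inv` (`MertensElementary`). Nothing on Möbius
sums over rough numbers existed (`lean search 'Coprime.*moebius.*div|rough.*moebius'`).
-/

noncomputable section

open Finset Real
open scoped ArithmeticFunction.Moebius ArithmeticFunction.zeta

namespace Literature.NumberTheory.Sieve

namespace MoebiusRough

/-! ### The Legendre-type identity `μ(n)·[(n, P) = 1] = ∑_{bk = n, b smooth} μ(k)` -/

/-- A prime `p` divides `P_N = ∏_{q < N} q` iff `p < N`. [folklore] -/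
theorem prime_dvd_prod_primesBelow_iff {p : ℕ} (hp : p.Prime) (N : ℕ) :
    p ∣ ∏ q ∈ N.primesBelow, q ↔ p < N := by
  rw [(Nat.prime_iff.mp hp).dvd_finsetProd_iff]
  constructor
  · rintro ⟨q, hq, hpq⟩
    obtain ⟨hqN, hqp⟩ := Nat.mem_primesBelow.mp hq
    rwa [(Nat.prime_dvd_prime_iff_eq hp hqp).mp hpq]
  · intro h
    exact ⟨p, Nat.mem_primesBelow.mpr ⟨h, hp⟩, dvd_rfl⟩

/-- A prime power `p^(i+1)` is `N`-smooth iff `p < N`. [folklore] -/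
theorem prime_pow_succ_mem_smoothNumbers_iff {p : ℕ} (hp : p.Prime) (N i : ℕ) :
    p ^ (i + 1) ∈ N.smoothNumbers ↔ p < N := by
  rw [Nat.mem_smoothNumbers']
  constructor
  · intro h
    exact h p hp (dvd_pow_self p (Nat.succ_ne_zero i))
  · intro h q hq hqd
    rwa [(Nat.prime_dvd_prime_iff_eq hq hp).mp (hq.dvd_of_dvd_pow hqd)]

/-- `1` is `N`-smooth. [folklore] -/
theorem one_mem_smoothNumbers (N : ℕ) : 1 ∈ N.smoothNumbers :=
  Nat.mem_smoothNumbers'.mpr fun _ hp hd => absurd (Nat.dvd_one.mp hd) hp.ne_one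

/-- **The Legendre-type identity** behind the smooth/rough decomposition of the Möbius harmonic
sum: for every `n` and `P = ∏_{q < N} q`,
`μ(n)·[(n, P) = 1] = ∑_{b ∣ n, b N-smooth} μ(n/b)`, i.e. `μ·1_{rough} = 1_{smooth} * μ` as
Dirichlet series (`∏_{p ≥ N}(1 - p^{-s}) = ∏_{p<N}(1 - p^{-s})⁻¹ · ∏_p (1 - p^{-s})`); proved by
comparing the multiplicative functions `(μ·1_{rough}) * ζ` and `1_{smooth}` on prime powers.
[folklore] -/
theorem ite_coprime_moebius_eq_sum_divisors (N n : ℕ) :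
    (if n.Coprime (∏ p ∈ N.primesBelow, p) then (μ n : ℝ) else 0) =
      ∑ b ∈ n.divisors, (if b ∈ N.smoothNumbers then (1 : ℝ) else 0) * (μ (n / b) : ℝ) := by
  classical
  set P : ℕ := ∏ p ∈ N.primesBelow, p with hP
  set σ : ArithmeticFunction ℝ := ⟨fun b => if b ∈ N.smoothNumbers then (1 : ℝ) else 0, by
    show (if (0 : ℕ) ∈ N.smoothNumbers then (1 : ℝ) else 0) = 0
    rw [if_neg]
    exact fun h => Nat.ne_zero_of_mem_smoothNumbers h rfl⟩ with hσ
  set ρ : ArithmeticFunction ℝ := ⟨fun n => if n.Coprime P then (μ n : ℝ) else 0, by simp⟩ with hρ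
  have hσ_apply : ∀ b : ℕ, σ b = if b ∈ N.smoothNumbers then (1 : ℝ) else 0 := fun b => rfl
  have hρ_apply : ∀ n : ℕ, ρ n = if n.Coprime P then (μ n : ℝ) else 0 := fun n => rfl
  -- multiplicativity of `σ`
  have hσm : σ.IsMultiplicative := by
    refine ⟨?_, ?_⟩
    · rw [hσ_apply, if_pos (one_mem_smoothNumbers N)]
    · intro m n _
      rw [hσ_apply, hσ_apply, hσ_apply]
      by_cases hm : m ∈ N.smoothNumbers
      · by_cases hn' : n ∈ N.smoothNumbers
        · rw [if_pos (Nat.mul_mem_smoothNumbers hm hn'), if_pos hm, if_pos hn', one_mul]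
        · rw [if_neg, if_pos hm, if_neg hn', mul_zero]
          exact fun h => hn' (Nat.mem_smoothNumbers_of_dvd h (dvd_mul_left n m))
      · rw [if_neg, if_neg hm, zero_mul]
        exact fun h => hm (Nat.mem_smoothNumbers_of_dvd h (dvd_mul_right m n))
  -- multiplicativity of `ρ`
  have hρm : ρ.IsMultiplicative := by
    refine ⟨?_, ?_⟩
    · rw [hρ_apply, if_pos (Nat.coprime_one_left _), ArithmeticFunction.moebius_apply_one]
      norm_num
    · intro m n hmn
      rw [hρ_apply, hρ_apply, hρ_apply,
        ArithmeticFunction.isMultiplicative_moebius.map_mul_of_coprime hmn, Int.cast_mul]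
      by_cases hm : m.Coprime P
      · by_cases hn' : n.Coprime P
        · rw [if_pos (Nat.Coprime.mul_left hm hn'), if_pos hm, if_pos hn']
        · rw [if_neg (fun h => hn' (Nat.coprime_mul_iff_left.mp h).2), if_pos hm, if_neg hn',
            mul_zero]
      · rw [if_neg (fun h => hm (Nat.coprime_mul_iff_left.mp h).1), if_neg hm, zero_mul]
  -- `ρ * ζ = σ` on prime powers
  have hkey : ρ * (ζ : ArithmeticFunction ℝ) = σ := by
    rw [ArithmeticFunction.IsMultiplicative.eq_iff_eq_on_prime_powers _
      (hρm.mul ArithmeticFunction.isMultiplicative_zeta.natCast) _ hσm]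
    intro p i hp
    rw [ArithmeticFunction.coe_mul_zeta_apply, Nat.sum_divisors_prime_pow hp]
    have hρ1 : ρ 1 = 1 := hρm.map_one
    have hρp : ρ p = if p < N then 0 else -1 := by
      rw [hρ_apply, ArithmeticFunction.moebius_apply_prime hp]
      have hiff : p.Coprime P ↔ ¬ p < N := by
        rw [hp.coprime_iff_not_dvd, prime_dvd_prod_primesBelow_iff hp]
      by_cases h : p < N
      · rw [if_neg (fun hc => hiff.mp hc h), if_pos h]
      · rw [if_pos (hiff.mpr h), if_neg h]
        norm_num
    have hρpp : ∀ x : ℕ, ρ (p ^ (x + 2)) = 0 := by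
      intro x
      rw [hρ_apply, ArithmeticFunction.moebius_apply_prime_pow hp (Nat.succ_ne_zero _)]
      simp
    cases i with
    | zero =>
      rw [Finset.sum_range_one, pow_zero, hρ1, hσm.map_one]
    | succ j =>
      rw [Finset.sum_range_succ', Finset.sum_range_succ', pow_zero, pow_one, hρ1, hρp,
        Finset.sum_eq_zero (fun x _ => hρpp x), zero_add, hσ_apply]
      have hiff := prime_pow_succ_mem_smoothNumbers_iff hp N j
      by_cases h : p < N
      · rw [if_pos h, if_pos (hiff.mpr h)]
        norm_num
      · rw [if_neg h, if_neg (fun hm => h (hiff.mp hm))]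
        norm_num
  -- hence `ρ = σ * μ`
  have hρσ : ρ = σ * (μ : ArithmeticFunction ℝ) := by
    rw [← hkey, mul_assoc, ArithmeticFunction.coe_zeta_mul_coe_moebius, mul_one]
  have h := congrArg (fun f : ArithmeticFunction ℝ => f n) hρσ
  simp only [hρ_apply] at h
  rw [h, ArithmeticFunction.mul_apply, Nat.sum_divisorsAntidiagonal (f := fun a b => σ a * (μ : ArithmeticFunction ℝ) b)]
  refine Finset.sum_congr rfl fun b _ => ?_
  rw [hσ_apply, ArithmeticFunction.intCoe_apply]

/-- **Smooth decomposition of the rough Möbius harmonic sum**: for `W ≥ 0` and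
`P = ∏_{q < N} q`,
`∑_{n ≤ W, (n, P) = 1} μ(n)/n = ∑_{b ≤ W, b N-smooth} b⁻¹ ∑_{k ≤ W/b} μ(k)/k`
(sum the Legendre-type identity against `1/n` and collect `n = bk`). [folklore] -/
theorem sum_coprime_moebius_div_eq (N W : ℕ) :
    ∑ n ∈ (Icc 1 W).filter (fun n => n.Coprime (∏ p ∈ N.primesBelow, p)), (μ n : ℝ) / n =
      ∑ b ∈ (Icc 1 W).filter (· ∈ N.smoothNumbers),
        (b : ℝ)⁻¹ * ∑ k ∈ Icc 1 (W / b), (μ k : ℝ) / k := by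
  classical
  -- Step A: insert the identity
  have hA : ∑ n ∈ (Icc 1 W).filter (fun n => n.Coprime (∏ p ∈ N.primesBelow, p)), (μ n : ℝ) / n =
      ∑ n ∈ Icc 1 W, ∑ b ∈ Icc 1 W, if b ∣ n then
        (if b ∈ N.smoothNumbers then (1 : ℝ) else 0) * (μ (n / b) : ℝ) / n else 0 := by
    rw [Finset.sum_filter]
    refine Finset.sum_congr rfl fun n hn => ?_
    have hn1 : 1 ≤ n := (Finset.mem_Icc.mp hn).1
    have hn0 : n ≠ 0 := by omega
    have h1 : (if n.Coprime (∏ p ∈ N.primesBelow, p) then (μ n : ℝ) / n else 0) =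
        (if n.Coprime (∏ p ∈ N.primesBelow, p) then (μ n : ℝ) else 0) / n := by
      split_ifs <;> simp
    rw [h1, ite_coprime_moebius_eq_sum_divisors N n, Finset.sum_div, ← Finset.sum_filter]
    refine Finset.sum_congr ?_ fun b _ => rfl
    ext b
    simp only [Nat.mem_divisors, Finset.mem_filter, Finset.mem_Icc]
    constructor
    · rintro ⟨hb, -⟩
      exact ⟨⟨Nat.pos_of_dvd_of_pos hb (by omega), (Nat.le_of_dvd (by omega) hb).trans
        (Finset.mem_Icc.mp hn).2⟩, hb⟩
    · rintro ⟨-, hb⟩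
      exact ⟨hb, hn0⟩
  -- Step B: swap and reindex `n = b k`
  rw [hA, Finset.sum_comm, Finset.sum_filter]
  refine Finset.sum_congr rfl fun b hb => ?_
  have hb0 : 0 < b := (Finset.mem_Icc.mp hb).1
  split_ifs with hbs
  · rw [← Finset.sum_filter, filter_dvd_Icc_eq_image hb0, Finset.sum_image
      (fun c₁ _ c₂ _ h => Nat.eq_of_mul_eq_mul_left hb0 h), Finset.mul_sum]
    refine Finset.sum_congr rfl fun k hk => ?_
    have hk0 : 0 < k := (Finset.mem_Icc.mp hk).1
    rw [Nat.mul_div_cancel_left k hb0, one_mul, Nat.cast_mul]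
    field_simp
  · refine Finset.sum_eq_zero fun n _ => ?_
    rw [zero_mul, zero_div, ite_self]

/-! ### Euler-product bounds for sums over smooth numbers -/

/-- For `t > 0` and a finite set `s` of `N`-smooth numbers,
`∑_{b ∈ s} b^{-t} ≤ ∏_{p < N} (1 - p^{-t})⁻¹` (the Euler product over `N`-smooth numbers,
Mathlib's `EulerProduct.summable_and_hasSum_smoothNumbers_prod_primesBelow_geometric`).
[folklore] -/
theorem sum_rpow_neg_le_prod_of_smooth {t : ℝ} (ht : 0 < t) (N : ℕ) (s : Finset ℕ)
    (hs : ∀ b ∈ s, b ∈ N.smoothNumbers) :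
    ∑ b ∈ s, (b : ℝ) ^ (-t) ≤ ∏ p ∈ N.primesBelow, (1 - (p : ℝ) ^ (-t))⁻¹ := by
  classical
  let f : ℕ →* ℝ :=
    { toFun := fun n => (n : ℝ) ^ (-t)
      map_one' := by simp
      map_mul' := fun m n => by
        simp only [Nat.cast_mul]
        exact Real.mul_rpow (Nat.cast_nonneg m) (Nat.cast_nonneg n) }
  have hf : ∀ n : ℕ, f n = (n : ℝ) ^ (-t) := fun n => rfl
  have h1 : ∀ {p : ℕ}, p.Prime → ‖f p‖ < 1 := by
    intro p hp
    rw [hf, Real.norm_eq_abs, abs_of_nonneg (Real.rpow_nonneg (Nat.cast_nonneg p) _)]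
    exact Real.rpow_lt_one_of_one_lt_of_neg (by exact_mod_cast hp.one_lt) (by linarith)
  obtain ⟨-, hsum⟩ :=
    EulerProduct.summable_and_hasSum_smoothNumbers_prod_primesBelow_geometric h1 N
  have key : ∑ b ∈ s, (b : ℝ) ^ (-t) =
      ∑ x ∈ s.subtype (· ∈ N.smoothNumbers), f (x : ℕ) := by
    rw [Finset.sum_subtype_eq_sum_filter, Finset.filter_true_of_mem hs]
    simp only [hf]
  rw [key]
  refine sum_le_hasSum _ (fun x _ => ?_) hsum
  rw [hf]
  exact Real.rpow_nonneg (Nat.cast_nonneg _) _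

/-- `∏_{p < N} (1 - 1/p)⁻¹ ≤ e⁵ log N` for `N ≥ 3` (the tree's elementary Mertens product bound
`Literature.NumberTheory.LFunctions.MertensBound.exp_neg_div_log_le_prod_one_sub_inv`). [folklore] -/
theorem prod_primesBelow_one_sub_inv_inv_le {N : ℕ} (hN : 3 ≤ N) :
    ∏ p ∈ N.primesBelow, (1 - (p : ℝ)⁻¹)⁻¹ ≤ Real.exp 5 * Real.log N := by
  have hN1 : 2 ≤ N - 1 := by omega
  have h := Literature.NumberTheory.LFunctions.MertensBound.exp_neg_div_log_le_prod_one_sub_inv (N - 1) hN1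
  have hcast : ((N - 1 : ℕ) : ℝ) = (N : ℝ) - 1 := by
    rw [Nat.cast_sub (by omega)]; norm_num
  have hN3 : (3 : ℝ) ≤ N := by exact_mod_cast hN
  have hlogN1 : 0 < Real.log ((N - 1 : ℕ) : ℝ) := by
    rw [hcast]; exact Real.log_pos (by linarith)
  have hlogle : Real.log ((N - 1 : ℕ) : ℝ) ≤ Real.log N := by
    rw [hcast]
    exact Real.log_le_log (by linarith) (by linarith)
  have hpos : 0 < Real.exp (-5) / Real.log ((N - 1 : ℕ) : ℝ) := div_pos (Real.exp_pos _) hlogN1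
  rw [Nat.primesBelow_eq_primesLE_sub_one, Finset.prod_inv_distrib]
  have hprod : ∏ p ∈ Nat.primesLE (N - 1), (1 - (p : ℝ)⁻¹) =
      ∏ p ∈ Nat.primesLE (N - 1), (1 - 1 / (p : ℝ)) := by
    simp_rw [one_div]
  rw [hprod]
  calc (∏ p ∈ Nat.primesLE (N - 1), (1 - 1 / (p : ℝ)))⁻¹
      ≤ (Real.exp (-5) / Real.log ((N - 1 : ℕ) : ℝ))⁻¹ := inv_anti₀ hpos h
    _ = Real.exp 5 * Real.log ((N - 1 : ℕ) : ℝ) := by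
        rw [inv_div, Real.exp_neg, div_inv_eq_mul, mul_comm]
    _ ≤ Real.exp 5 * Real.log N := by gcongr

/-- `log 8 ≥ 2` (numerics: `e² < 7.39`). [folklore] -/
theorem two_le_log_eight : (2 : ℝ) ≤ Real.log 8 := by
  rw [Real.le_log_iff_exp_le (by norm_num)]
  have h1 := Real.exp_one_lt_d9
  have h2 : Real.exp 2 = Real.exp 1 * Real.exp 1 := by rw [← Real.exp_add]; norm_num
  rw [h2]
  nlinarith [Real.exp_pos 1]

/-- The Rankin weight at a single prime: for `N ≥ 8`, `ε = 1/log N` and a prime `p < N`,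
`(1 - p^{ε-1})⁻¹ ≤ (1 - 1/p)^{-12}` (since `p^{ε-1} ≤ min(e/p, 2^{-1/2})`, so
`(1 - p^{ε-1})⁻¹ ≤ 1 + 4 p^{ε-1} ≤ 1 + 12/p ≤ (1 - 1/p)^{-12}`). [folklore] -/
theorem rankin_factor_le {N p : ℕ} (hN : 8 ≤ N) (hp : p.Prime) (hpN : p < N) :
    (1 - (p : ℝ) ^ (-(1 - 1 / Real.log N)))⁻¹ ≤ ((1 - (p : ℝ)⁻¹)⁻¹) ^ 12 := by
  have hN8 : (8 : ℝ) ≤ N := by exact_mod_cast hN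
  have hlogN : 2 ≤ Real.log N := two_le_log_eight.trans (Real.log_le_log (by norm_num) hN8)
  have hlogN0 : 0 < Real.log N := by linarith
  have hp2 : (2 : ℝ) ≤ p := by exact_mod_cast hp.two_le
  have hp0 : (0 : ℝ) < p := by linarith
  have hp1 : (1 : ℝ) ≤ p := by linarith
  set ε : ℝ := 1 / Real.log N with hε
  have hε0 : 0 ≤ ε := by positivity
  have hε2 : ε ≤ 1 / 2 := by
    rw [hε]; exact one_div_le_one_div_of_le (by norm_num) hlogN
  set x : ℝ := (p : ℝ) ^ (-(1 - ε)) with hx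
  -- `x ≤ 3/p`
  have hx3 : x ≤ 3 / p := by
    have hsplit : x = (p : ℝ) ^ ε * (p : ℝ)⁻¹ := by
      rw [hx, show -(1 - ε) = ε + (-1) by ring, Real.rpow_add hp0, Real.rpow_neg_one]
    have hpe : (p : ℝ) ^ ε ≤ 3 := by
      rw [Real.rpow_def_of_pos hp0]
      have hlogp : Real.log p ≤ Real.log N :=
        Real.log_le_log hp0 (by exact_mod_cast hpN.le)
      have h1 : Real.log p * ε ≤ 1 := by
        rw [hε]
        calc Real.log p * (1 / Real.log N) = Real.log p / Real.log N := by ring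
          _ ≤ 1 := (div_le_one hlogN0).mpr hlogp
      calc Real.exp (Real.log p * ε) ≤ Real.exp 1 := Real.exp_le_exp.mpr h1
        _ ≤ 3 := by have := Real.exp_one_lt_d9; linarith
    rw [hsplit, div_eq_mul_inv]
    exact mul_le_mul_of_nonneg_right hpe (inv_nonneg.mpr hp0.le)
  -- `x ≤ 3/4`
  have hx34 : x ≤ 3 / 4 := by
    calc x ≤ (p : ℝ) ^ (-(1 / 2 : ℝ)) := by
          rw [hx]
          exact Real.rpow_le_rpow_of_exponent_le hp1 (by linarith)
      _ ≤ (2 : ℝ) ^ (-(1 / 2 : ℝ)) := Real.rpow_le_rpow_of_nonpos (by norm_num) hp2 (by norm_num)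
      _ = (Real.sqrt 2)⁻¹ := by
          rw [Real.rpow_neg (by norm_num), Real.sqrt_eq_rpow]
      _ ≤ 3 / 4 := by
          rw [inv_le_comm₀ (Real.sqrt_pos.mpr (by norm_num)) (by norm_num)]
          rw [show (3 / 4 : ℝ)⁻¹ = 4 / 3 by norm_num, Real.le_sqrt (by norm_num) (by norm_num)]
          norm_num
  have hx0 : 0 ≤ x := Real.rpow_nonneg hp0.le _
  -- `(1 - x)⁻¹ ≤ 1 + 4x ≤ 1 + 12/p`
  have h1x : 0 < 1 - x := by linarith
  have hstep1 : (1 - x)⁻¹ ≤ 1 + 4 * x := by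
    rw [inv_le_iff_one_le_mul₀' h1x]
    nlinarith
  have hstep2 : 1 + 4 * x ≤ 1 + 12 * (p : ℝ)⁻¹ := by
    have : 4 * x ≤ 12 * (p : ℝ)⁻¹ := by
      calc 4 * x ≤ 4 * (3 / p) := by linarith
        _ = 12 * (p : ℝ)⁻¹ := by ring
    linarith
  -- `1 + 12 y ≤ (1 - y)^{-12}`, `y = 1/p`
  have hstep3 : 1 + 12 * (p : ℝ)⁻¹ ≤ ((1 - (p : ℝ)⁻¹)⁻¹) ^ 12 := by
    set y : ℝ := (p : ℝ)⁻¹ with hy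
    have hy0 : 0 ≤ y := inv_nonneg.mpr hp0.le
    have hy1 : y ≤ 1 / 2 := by rw [hy, ← one_div]; exact one_div_le_one_div_of_le (by norm_num) hp2
    have h1y : 0 < 1 - y := by linarith
    rw [inv_pow, le_inv_comm₀ (by positivity) (pow_pos h1y 12)]
    -- `(1-y)^12 ≤ (1 + 12y)⁻¹` iff `(1 + 12y)(1-y)^12 ≤ 1`
    rw [le_inv_comm₀ (pow_pos h1y 12) (by positivity), inv_eq_one_div, le_div_iff₀ (by positivity)]
    have ha : (1 - y) ^ 12 ≤ Real.exp (-y) ^ 12 :=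
      pow_le_pow_left₀ h1y.le (by have := Real.one_sub_le_exp_neg y; linarith) 12
    have hb : 1 + 12 * y ≤ Real.exp (12 * y) := by
      have := Real.add_one_le_exp (12 * y); linarith
    have hc : Real.exp (-y) ^ 12 * Real.exp (12 * y) = 1 := by
      rw [← Real.exp_nat_mul, ← Real.exp_add]; norm_num
    calc (1 + 12 * y) * (1 - y) ^ 12 ≤ Real.exp (12 * y) * Real.exp (-y) ^ 12 :=
          mul_le_mul hb ha (by positivity) (by positivity)
      _ = 1 := by rw [mul_comm]; exact hc
  exact hstep1.trans (hstep2.trans hstep3)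

/-- The Rankin product: for `N ≥ 8` and `ε = 1/log N`,
`∏_{p < N} (1 - p^{ε-1})⁻¹ ≤ (e⁵ log N)^{12}`. [folklore] -/
theorem rankin_prod_le {N : ℕ} (hN : 8 ≤ N) :
    ∏ p ∈ N.primesBelow, (1 - (p : ℝ) ^ (-(1 - 1 / Real.log N)))⁻¹ ≤
      (Real.exp 5 * Real.log N) ^ 12 := by
  have hfac : ∀ p ∈ N.primesBelow, 0 ≤ (1 - (p : ℝ) ^ (-(1 - 1 / Real.log N)))⁻¹ := by
    intro p hp
    obtain ⟨hpN, hpp⟩ := Nat.mem_primesBelow.mp hp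
    have hN8 : (8 : ℝ) ≤ N := by exact_mod_cast hN
    have hlogN : 2 ≤ Real.log N := two_le_log_eight.trans (Real.log_le_log (by norm_num) hN8)
    have hp1 : (1 : ℝ) < p := by exact_mod_cast hpp.one_lt
    have : (p : ℝ) ^ (-(1 - 1 / Real.log N)) < 1 := by
      refine Real.rpow_lt_one_of_one_lt_of_neg hp1 ?_
      have : 1 / Real.log N ≤ 1 / 2 := one_div_le_one_div_of_le (by norm_num) hlogN
      linarith
    exact inv_nonneg.mpr (by linarith)
  calc ∏ p ∈ N.primesBelow, (1 - (p : ℝ) ^ (-(1 - 1 / Real.log N)))⁻¹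
      ≤ ∏ p ∈ N.primesBelow, ((1 - (p : ℝ)⁻¹)⁻¹) ^ 12 :=
        Finset.prod_le_prod hfac fun p hp =>
          rankin_factor_le hN (Nat.prime_of_mem_primesBelow hp) (Nat.lt_of_mem_primesBelow hp)
    _ = (∏ p ∈ N.primesBelow, (1 - (p : ℝ)⁻¹)⁻¹) ^ 12 := Finset.prod_pow _ _ _
    _ ≤ (Real.exp 5 * Real.log N) ^ 12 := by
        refine pow_le_pow_left₀ ?_ (prod_primesBelow_one_sub_inv_inv_le (by omega)) 12
        refine Finset.prod_nonneg fun p hp => ?_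
        have hp1 : (1 : ℝ) < p := by exact_mod_cast (Nat.prime_of_mem_primesBelow hp).one_lt
        have : (p : ℝ)⁻¹ < 1 := inv_lt_one_of_one_lt₀ hp1
        exact inv_nonneg.mpr (by linarith)

/-! ### The bound for `F(w, z)` -/

/-- **The rough Möbius harmonic sum is small**: if `|∑_{k ≤ x} μ(k)/k| ≤ C e^{-c√log x}` for
`x ≥ 2` (PROVED in the tree, `Literature.NumberTheory.LFunctions.abs_sum_moebius_div_le_exp_neg_sqrt_log`), then for `w ≥ 2`,
`N ≥ 8` and `P = ∏_{q < N} q`,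
`|∑_{n ≤ w, (n, P) = 1} μ(n)/n| ≤ (C+1) e^{c+5} log N · e^{-(c/2)√log w}
  + (C+1) (e⁵ log N)^{12} e^{-log w/(2 log N)}`.
Proof: by `sum_coprime_moebius_div_eq` the sum is `∑_{b ≤ w, smooth} b⁻¹ m(w/b)`,
`m(x) = ∑_{k ≤ x} μ(k)/k`; for `b ≤ √w` use `|m(w/b)| ≤ C e^{-c√(log w/2)}` and
`∑_{b smooth} 1/b ≤ ∏_{p<N}(1 - 1/p)⁻¹ ≤ e⁵ log N`; for `b > √w` use `|m| ≤ C + 1` and Rankin's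
trick `∑_{b > √w, smooth} 1/b ≤ w^{-ε/2} ∑_{b smooth} b^{ε-1} = w^{-ε/2} ∏_{p<N} (1 - p^{ε-1})⁻¹`
with `ε = 1/log N`. This replaces the "standard contour integration" giving
`F(w, z) ≪ z^{-c} + exp(-log w/log z)(log z)⁶` in Friedlander–Iwaniec's proof of (2.4)
(p. 1049). [cite: FriedlanderIwaniecASP1998, §2 p. 1049] -/
theorem abs_sum_coprime_moebius_div_le {c C : ℝ} (hc : 0 < c) (hC : 0 ≤ C)
    (hm : ∀ x : ℝ, 2 ≤ x →
      |∑ k ∈ Icc 1 ⌊x⌋₊, (μ k : ℝ) / k| ≤ C * Real.exp (-c * Real.sqrt (Real.log x)))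
    {w : ℝ} (hw : 2 ≤ w) {N : ℕ} (hN : 8 ≤ N) :
    |∑ n ∈ (Icc 1 ⌊w⌋₊).filter (fun n => n.Coprime (∏ p ∈ N.primesBelow, p)), (μ n : ℝ) / n| ≤
      (C + 1) * Real.exp (c + 5) * Real.log N * Real.exp (-(c / 2) * Real.sqrt (Real.log w)) +
        (C + 1) * (Real.exp 5 * Real.log N) ^ 12 *
          Real.exp (-(Real.log w / (2 * Real.log N))) := by
  classical
  have hw0 : 0 < w := by linarith
  have hw1 : 1 ≤ w := by linarith
  have hlogw : 0 < Real.log w := Real.log_pos (by linarith)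
  have hN8 : (8 : ℝ) ≤ N := by exact_mod_cast hN
  have hlogN : 2 ≤ Real.log N := two_le_log_eight.trans (Real.log_le_log (by norm_num) hN8)
  have hlogN0 : 0 < Real.log N := by linarith
  set ε : ℝ := 1 / Real.log N with hε
  have hε0 : 0 < ε := by positivity
  have hε1 : ε ≤ 1 / 2 := one_div_le_one_div_of_le (by norm_num) hlogN
  set W : ℕ := ⌊w⌋₊ with hW
  set S : Finset ℕ := (Icc 1 W).filter (· ∈ N.smoothNumbers) with hS
  -- the inner sums `m(w/b)`
  set m : ℕ → ℝ := fun b => ∑ k ∈ Icc 1 (W / b), (μ k : ℝ) / k with hmdef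
  have hm_real : ∀ b : ℕ, m b = ∑ k ∈ Icc 1 ⌊w / b⌋₊, (μ k : ℝ) / k := by
    intro b; rw [hmdef, Nat.floor_div_natCast]
  -- (1) `|m b| ≤ C + 1` for `1 ≤ b ≤ W`
  have hm_triv : ∀ b ∈ Icc 1 W, |m b| ≤ C + 1 := by
    intro b hb
    obtain ⟨hb1, hbW⟩ := Finset.mem_Icc.mp hb
    have hb0 : (0 : ℝ) < b := by exact_mod_cast hb1
    have hbw : (b : ℝ) ≤ w := (Nat.cast_le.mpr hbW).trans (Nat.floor_le hw0.le)
    rw [hm_real]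
    by_cases h2 : 2 ≤ w / b
    · calc |∑ k ∈ Icc 1 ⌊w / b⌋₊, (μ k : ℝ) / k| ≤ C * Real.exp (-c * Real.sqrt (Real.log (w / b))) :=
            hm _ h2
        _ ≤ C * 1 := by
            refine mul_le_mul_of_nonneg_left ?_ hC
            rw [Real.exp_le_one_iff]
            have := Real.sqrt_nonneg (Real.log (w / b))
            nlinarith
        _ ≤ C + 1 := by linarith
    · have hfl : ⌊w / b⌋₊ = 1 := by
        rw [Nat.floor_eq_iff (div_nonneg hw0.le hb0.le)]
        constructor
        · rw [Nat.cast_one, le_div_iff₀ hb0, one_mul]; exact hbw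
        · push_cast; linarith [not_le.mp h2]
      rw [hfl, Finset.Icc_self, Finset.sum_singleton, ArithmeticFunction.moebius_apply_one]
      norm_num
      linarith
  -- (2) for `b² ≤ w`: `|m b| ≤ (C+1) e^c e^{-(c/2)√log w}`
  have hm_small : ∀ b ∈ Icc 1 W, (b : ℝ) ^ 2 ≤ w →
      |m b| ≤ (C + 1) * Real.exp c * Real.exp (-(c / 2) * Real.sqrt (Real.log w)) := by
    intro b hb hb2
    obtain ⟨hb1, hbW⟩ := Finset.mem_Icc.mp hb
    have hb0 : (0 : ℝ) < b := by exact_mod_cast hb1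
    have hec : 1 ≤ Real.exp c := Real.one_le_exp hc.le
    by_cases h4 : 4 ≤ w
    · -- `w/b ≥ √w ≥ 2`
      have hsqw : 2 ≤ Real.sqrt w := by
        rw [show (2 : ℝ) = Real.sqrt 4 by rw [show (4:ℝ) = 2 ^ 2 by norm_num, Real.sqrt_sq (by norm_num)]]
        exact Real.sqrt_le_sqrt h4
      have hbsq : (b : ℝ) ≤ Real.sqrt w := Real.le_sqrt_of_sq_le hb2
      have hwb : Real.sqrt w ≤ w / b := by
        rw [le_div_iff₀ hb0]
        calc Real.sqrt w * b ≤ Real.sqrt w * Real.sqrt w :=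
              mul_le_mul_of_nonneg_left hbsq (Real.sqrt_nonneg w)
          _ = w := Real.mul_self_sqrt hw0.le
      have h2 : 2 ≤ w / b := hsqw.trans hwb
      have hlog : Real.log w / 2 ≤ Real.log (w / b) := by
        have : Real.log (Real.sqrt w) = Real.log w / 2 := Real.log_sqrt hw0.le
        rw [← this]
        exact Real.log_le_log (by linarith) hwb
      have hsqrt : Real.sqrt (Real.log w) / 2 ≤ Real.sqrt (Real.log (w / b)) := by
        calc Real.sqrt (Real.log w) / 2 ≤ Real.sqrt (Real.log w / 2) := by
              refine Real.le_sqrt_of_sq_le ?_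
              rw [div_pow, Real.sq_sqrt hlogw.le]
              linarith
          _ ≤ Real.sqrt (Real.log (w / b)) := Real.sqrt_le_sqrt hlog
      rw [hm_real]
      calc |∑ k ∈ Icc 1 ⌊w / b⌋₊, (μ k : ℝ) / k| ≤ C * Real.exp (-c * Real.sqrt (Real.log (w / b))) :=
            hm _ h2
        _ ≤ C * Real.exp (-(c / 2) * Real.sqrt (Real.log w)) := by
            refine mul_le_mul_of_nonneg_left (Real.exp_le_exp.mpr ?_) hC
            nlinarith
        _ ≤ (C + 1) * Real.exp c * Real.exp (-(c / 2) * Real.sqrt (Real.log w)) := by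
            refine mul_le_mul_of_nonneg_right ?_ (Real.exp_pos _).le
            nlinarith
    · -- `2 ≤ w < 4`: `√log w < 2`
      have hlog4 : Real.log w < 2 := by
        have : Real.log w < Real.log 4 := Real.log_lt_log hw0 (not_le.mp h4)
        have h4' : Real.log 4 ≤ 2 := by
          rw [Real.log_le_iff_le_exp (by norm_num)]
          have h1 := Real.exp_one_gt_d9
          have h2 : Real.exp 2 = Real.exp 1 * Real.exp 1 := by rw [← Real.exp_add]; norm_num
          rw [h2]; nlinarith
        linarith
      have hsq : Real.sqrt (Real.log w) ≤ 2 := by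
        rw [Real.sqrt_le_left (by norm_num)]
        nlinarith
      have hexp : Real.exp (-c) ≤ Real.exp (-(c / 2) * Real.sqrt (Real.log w)) := by
        rw [Real.exp_le_exp]; nlinarith
      have hcc : Real.exp c * Real.exp (-c) = 1 := by rw [← Real.exp_add]; simp
      calc |m b| ≤ C + 1 := hm_triv b hb
        _ = (C + 1) * Real.exp c * Real.exp (-c) := by rw [mul_assoc, hcc, mul_one]
        _ ≤ (C + 1) * Real.exp c * Real.exp (-(c / 2) * Real.sqrt (Real.log w)) :=
            mul_le_mul_of_nonneg_left hexp (by positivity)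
  -- (3) smooth-number sums
  have hSsmooth : ∀ b ∈ S, b ∈ N.smoothNumbers := fun b hb => (Finset.mem_filter.mp hb).2
  have hsum1 : ∑ b ∈ S.filter (fun b : ℕ => (b : ℝ) ^ 2 ≤ w), (b : ℝ)⁻¹ ≤ Real.exp 5 * Real.log N := by
    have h := sum_rpow_neg_le_prod_of_smooth one_pos N (S.filter (fun b : ℕ => (b : ℝ) ^ 2 ≤ w))
      (fun b hb => hSsmooth b (Finset.mem_filter.mp hb).1)
    simp only [Real.rpow_neg_one] at h
    exact h.trans (prod_primesBelow_one_sub_inv_inv_le (by omega))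
  have hsum2 : ∑ b ∈ S.filter (fun b : ℕ => ¬ (b : ℝ) ^ 2 ≤ w), (b : ℝ) ^ (-(1 - ε)) ≤
      (Real.exp 5 * Real.log N) ^ 12 := by
    have h := sum_rpow_neg_le_prod_of_smooth (t := 1 - ε) (by linarith) N
      (S.filter (fun b : ℕ => ¬ (b : ℝ) ^ 2 ≤ w)) (fun b hb => hSsmooth b (Finset.mem_filter.mp hb).1)
    exact h.trans (rankin_prod_le hN)
  -- (4) Rankin: for `b² > w`, `b⁻¹ ≤ w^{-ε/2} b^{-(1-ε)}`
  have hrankin : ∀ b ∈ S, ¬ (b : ℝ) ^ 2 ≤ w →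
      (b : ℝ)⁻¹ ≤ Real.exp (-(Real.log w / (2 * Real.log N))) * (b : ℝ) ^ (-(1 - ε)) := by
    intro b hb hb2
    have hb1 : 1 ≤ b := (Finset.mem_Icc.mp (Finset.mem_filter.mp hb).1).1
    have hb0 : (0 : ℝ) < b := by exact_mod_cast hb1
    have hwb : w < (b : ℝ) ^ 2 := not_le.mp hb2
    -- `b⁻¹ = b^{-ε} b^{-(1-ε)}` and `b^{-ε} ≤ (w^{1/2})^{-ε} = exp(-ε log w/2)`
    have hsplit : (b : ℝ)⁻¹ = (b : ℝ) ^ (-ε) * (b : ℝ) ^ (-(1 - ε)) := by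
      rw [← Real.rpow_add hb0, ← Real.rpow_neg_one]; ring_nf
    rw [hsplit]
    refine mul_le_mul_of_nonneg_right ?_ (Real.rpow_nonneg hb0.le _)
    have hsw : Real.sqrt w ≤ b := by
      rw [Real.sqrt_le_left hb0.le]; exact hwb.le
    calc (b : ℝ) ^ (-ε) ≤ (Real.sqrt w) ^ (-ε) :=
          Real.rpow_le_rpow_of_nonpos (Real.sqrt_pos.mpr hw0) hsw (by linarith)
      _ = Real.exp (-(Real.log w / (2 * Real.log N))) := by
          rw [Real.rpow_def_of_pos (Real.sqrt_pos.mpr hw0), Real.log_sqrt hw0.le, hε]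
          congr 1
          field_simp
  -- (5) assemble
  rw [sum_coprime_moebius_div_eq N W]
  change |∑ b ∈ S, (b : ℝ)⁻¹ * m b| ≤ _
  have hsplitS : ∑ b ∈ S, (b : ℝ)⁻¹ * m b =
      ∑ b ∈ S.filter (fun b : ℕ => (b : ℝ) ^ 2 ≤ w), (b : ℝ)⁻¹ * m b +
        ∑ b ∈ S.filter (fun b : ℕ => ¬ (b : ℝ) ^ 2 ≤ w), (b : ℝ)⁻¹ * m b :=
    (Finset.sum_filter_add_sum_filter_not S _ _).symm
  have hSsub : ∀ b ∈ S, b ∈ Icc 1 W := fun b hb => (Finset.mem_filter.mp hb).1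
  calc |∑ b ∈ S, (b : ℝ)⁻¹ * m b|
      ≤ |∑ b ∈ S.filter (fun b : ℕ => (b : ℝ) ^ 2 ≤ w), (b : ℝ)⁻¹ * m b| +
          |∑ b ∈ S.filter (fun b : ℕ => ¬ (b : ℝ) ^ 2 ≤ w), (b : ℝ)⁻¹ * m b| := by
        rw [hsplitS]; exact abs_add_le _ _
    _ ≤ ∑ b ∈ S.filter (fun b : ℕ => (b : ℝ) ^ 2 ≤ w), (b : ℝ)⁻¹ *
            ((C + 1) * Real.exp c * Real.exp (-(c / 2) * Real.sqrt (Real.log w))) +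
          ∑ b ∈ S.filter (fun b : ℕ => ¬ (b : ℝ) ^ 2 ≤ w),
            (Real.exp (-(Real.log w / (2 * Real.log N))) * (b : ℝ) ^ (-(1 - ε))) * (C + 1) := by
        refine add_le_add ?_ ?_
        · -- small `b`
          refine (Finset.abs_sum_le_sum_abs _ _).trans (Finset.sum_le_sum fun b hb => ?_)
          obtain ⟨hbS, hb2⟩ := Finset.mem_filter.mp hb
          have hb0 : (0 : ℝ) < b := by exact_mod_cast (Finset.mem_Icc.mp (hSsub b hbS)).1
          rw [abs_mul, abs_of_pos (inv_pos.mpr hb0)]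
          exact mul_le_mul_of_nonneg_left (hm_small b (hSsub b hbS) hb2) (inv_pos.mpr hb0).le
        · -- large `b`
          refine (Finset.abs_sum_le_sum_abs _ _).trans (Finset.sum_le_sum fun b hb => ?_)
          obtain ⟨hbS, hb2⟩ := Finset.mem_filter.mp hb
          have hb0 : (0 : ℝ) < b := by exact_mod_cast (Finset.mem_Icc.mp (hSsub b hbS)).1
          rw [abs_mul, abs_of_pos (inv_pos.mpr hb0)]
          exact mul_le_mul (hrankin b hbS hb2) (hm_triv b (hSsub b hbS)) (abs_nonneg _)
            (by positivity)
    _ = (C + 1) * Real.exp c * Real.exp (-(c / 2) * Real.sqrt (Real.log w)) *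
            ∑ b ∈ S.filter (fun b : ℕ => (b : ℝ) ^ 2 ≤ w), (b : ℝ)⁻¹ +
          (C + 1) * Real.exp (-(Real.log w / (2 * Real.log N))) *
            ∑ b ∈ S.filter (fun b : ℕ => ¬ (b : ℝ) ^ 2 ≤ w), (b : ℝ) ^ (-(1 - ε)) := by
        rw [Finset.mul_sum, Finset.mul_sum]
        congr 1 <;> refine Finset.sum_congr rfl fun b _ => ?_ <;> ring
    _ ≤ (C + 1) * Real.exp c * Real.exp (-(c / 2) * Real.sqrt (Real.log w)) *
            (Real.exp 5 * Real.log N) +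
          (C + 1) * Real.exp (-(Real.log w / (2 * Real.log N))) * (Real.exp 5 * Real.log N) ^ 12 := by
        gcongr
    _ = (C + 1) * Real.exp (c + 5) * Real.log N * Real.exp (-(c / 2) * Real.sqrt (Real.log w)) +
          (C + 1) * (Real.exp 5 * Real.log N) ^ 12 *
            Real.exp (-(Real.log w / (2 * Real.log N))) := by
        rw [Real.exp_add]; ring

end MoebiusRough

end Literature.NumberTheory.Sieve
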